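import Literature.Analysis.FluidPDE.OnsagerBDSVFlowJacobian
import HarnessLib

/-!
# The BDSV perturbation: Leibniz rules for the material derivative `D_{t,q} = ∂ₜ + v̄_q·∇`

Buckmaster–De Lellis–Székelyhidi–Vicol (BDSV), *Onsager's conjecture for admissible weak
solutions*, CPAM 72 (2019) = arXiv:1701.08678, §5.5, proof of Prop. 5.9: the material
derivatives of the products entering the perturbation are expanded by the Leibniz rule —
"Differentiating (5.27) we have
`D_{t,q}(ρ_{q,i}⁻¹R_{q,i}) = -(∂ₜ (∑_j∫η_j²/ρ_q)) R̊̄_q - (∑_j∫η_j²/ρ_q) D_{t,q}R̊̄_q`" (arXiv (5.41)),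
"Differentiating (5.17) we achieve `D_{t,q}R̃_{q,i} = D_{t,q}∇Φ_i (ρ_{q,i}⁻¹R_{q,i}) ∇Φ_iᵀ +
∇Φ_i D_{t,q}(ρ_{q,i}⁻¹R_{q,i}) ∇Φ_iᵀ + ∇Φ_i (ρ_{q,i}⁻¹R_{q,i}) (D_{t,q}∇Φ_i)ᵀ`", and
"`D_{t,q}∇Φ_i = -∇Φ_i Dv̄_q`". This file PROVES these calculus rules for the transport
derivative `BDSV.advectiveDeriv T v` of the tree (one-sided time derivative within `[0,T]`) and
jointly smooth fields on `[0,T] × T³`: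

* `BDSV.advectiveDeriv_bilinear`: `D_t B(f,g) = B(D_t f, g) + B(f, D_t g)` for a continuous
  bilinear `B`; `BDSV.advectiveDeriv_time_smul`: `D_t (θ(t) F) = θ'(t) F + θ(t) D_t F` for a
  time-only scalar factor; `BDSV.advectiveDeriv_congr` (locality on `[0,T] × T³`);
* the matrix plumbing of §5.5 as continuous linear / bilinear maps on `𝕄 = Matrix (Fin 3) (Fin 3) ℝ`
  (elementwise sup norm), obtained from finite-dimensionality and recorded as existence
  statements: the product `(X, Y) ↦ XY` (`BDSV.exists_matrixMulCLM`), the transpose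
  (`BDSV.exists_transposeCLM`), the columns-to-matrix map `BDSV.ofCols`
  (`BDSV.exists_ofColsCLM`) and the Jacobian-matrix map `φ ↦ (φ(e_b)_a)_{ab}` of a linear
  `φ : ℝ³ → ℝ³` (`BDSV.exists_jacCLM`), through which `∇Φ_i = Id + jac(∇D_i)`
  (`BDSV.gradPhi_eq_one_add_jac`) and
  **`D_{t,q}∇Φ_i = jac(-∇v̄_q - ∇D_i ∘ ∇v̄_q) (= -∇Φ_i Dv̄_q)`** (`BDSV.advectiveDeriv_gradPhi_eq`,
  from the accepted `BDSV.advectiveDeriv_gradField_eq`).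

## References

* T. Buckmaster, C. De Lellis, L. Székelyhidi Jr., V. Vicol, *Onsager's conjecture for admissible
  weak solutions*, Comm. Pure Appl. Math. 72 (2019) 229–274 = arXiv:1701.08678, §5.5, proof of
  Prop. 5.9 (arXiv (5.40)–(5.42) and the displays around them).
-/

open Set
open scoped ContDiff Matrix Matrix.Norms.Elementwise Topology

noncomputable section

namespace Literature.Analysis.FluidPDE

namespace BDSV

open FunctionSpaces FunctionSpaces.Torus

/-! ## Leibniz rules for the transport derivative -/

section Leibniz

variable {E₁ E₂ G : Type*} [NormedAddCommGroup E₁] [NormedSpace ℝ E₁] [NormedAddCommGroup E₂]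
  [NormedSpace ℝ E₂] [NormedAddCommGroup G] [NormedSpace ℝ G]
  {T : ℝ} {v : ℝ → UnitAddTorus (Fin 3) → EuclideanSpace ℝ (Fin 3)}

/-- The torus derivative of a smooth slice as a `HasFDerivAt` statement for the re-centred lift
at `0`. [folklore] -/
theorem hasFDerivAt_liftAt {f : UnitAddTorus (Fin 3) → G} (hf : IsSmooth f) (x : UnitAddTorus (Fin 3)) :
    HasFDerivAt (liftAt f x) (Torus.fderiv f x) 0 :=
  (((hf.liftAt x).differentiable (by simp)).differentiableAt).hasFDerivAt

/-- **Leibniz rule for the transport derivative through a continuous bilinear map**: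
`(∂ₜ + v·∇) B(f,g) = B((∂ₜ + v·∇)f, g) + B(f, (∂ₜ + v·∇)g)` on `[0,T] × T³` for jointly smooth
`f, g`. [cite: BuckmasterEtAl2018, Prop. 5.9 (proof: "Differentiating (5.17) we achieve …")] -/
theorem advectiveDeriv_bilinear (hT : 0 < T) (B : E₁ →L[ℝ] E₂ →L[ℝ] G) {f : ℝ → UnitAddTorus (Fin 3) → E₁}
    {g : ℝ → UnitAddTorus (Fin 3) → E₂} (hf : IsSmoothSpaceTimeOn (Icc 0 T) f) (hg : IsSmoothSpaceTimeOn (Icc 0 T) g)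
    {t : ℝ} (ht : t ∈ Icc 0 T) (x : UnitAddTorus (Fin 3)) :
    advectiveDeriv T v (fun s y => B (f s y) (g s y)) t x =
      B (advectiveDeriv T v f t x) (g t x) + B (f t x) (advectiveDeriv T v g t x) := by
  have hB := B.isBoundedBilinearMap
  -- the time derivative
  have htime : timeDerivWithin (Icc 0 T) (fun s y => B (f s y) (g s y)) t x =
      B (timeDerivWithin (Icc 0 T) f t x) (g t x) + B (f t x) (timeDerivWithin (Icc 0 T) g t x) := by
    have hpair : HasDerivWithinAt (fun s => (f s x, g s x))
        (timeDerivWithin (Icc 0 T) f t x, timeDerivWithin (Icc 0 T) g t x) (Icc 0 T) t :=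
      (hf.hasDerivWithinAt_slice ht x).prodMk (hg.hasDerivWithinAt_slice ht x)
    have hcomp := (hB.hasFDerivAt ((fun s => (f s x, g s x)) t)).comp_hasDerivWithinAt t hpair
    have h3 : HasDerivWithinAt (fun s => B (f s x) (g s x))
        (hB.deriv (f t x, g t x) (timeDerivWithin (Icc 0 T) f t x, timeDerivWithin (Icc 0 T) g t x))
        (Icc 0 T) t := hcomp
    unfold timeDerivWithin
    show derivWithin (fun s => B (f s x) (g s x)) (Icc 0 T) t = _
    rw [h3.derivWithin (uniqueDiffOn_Icc hT t ht)]
    simp only [IsBoundedBilinearMap.deriv_apply]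
    exact add_comm _ _
  -- the spatial derivative
  have hspace : Torus.fderiv (fun y => B (f t y) (g t y)) x (v t x) =
      B (Torus.fderiv (f t) x (v t x)) (g t x) + B (f t x) (Torus.fderiv (g t) x (v t x)) := by
    have h1 := hasFDerivAt_liftAt (hf.isSmooth_slice ht) x
    have h2 := hasFDerivAt_liftAt (hg.isSmooth_slice ht) x
    have hcomp := (hB.hasFDerivAt (liftAt (f t) x 0, liftAt (g t) x 0)).comp 0 (h1.prodMk h2)
    have h3 : HasFDerivAt (liftAt (fun y => B (f t y) (g t y)) x)
        ((hB.deriv (liftAt (f t) x 0, liftAt (g t) x 0)).comp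
          ((Torus.fderiv (f t) x).prod (Torus.fderiv (g t) x))) 0 := hcomp
    unfold Torus.fderiv
    rw [h3.fderiv]
    simp only [ContinuousLinearMap.coe_comp, Function.comp_apply, ContinuousLinearMap.prod_apply,
      IsBoundedBilinearMap.deriv_apply, liftAt_apply_zero]
    exact add_comm _ _
  rw [advectiveDeriv_apply, advectiveDeriv_apply, advectiveDeriv_apply, htime, hspace, B.map_add₂,
    map_add]
  abel

/-- **Time-only scalar factors**: `(∂ₜ + v·∇)(θ(t) F) = θ'(t) F + θ(t) (∂ₜ + v·∇)F` on `[0,T] × T³`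
when `θ` has one-sided derivative `θ'` within `[0,T]` at `t`. [cite: BuckmasterEtAl2018, Prop. 5.9 (proof, arXiv (5.41))] -/
theorem advectiveDeriv_time_smul (hT : 0 < T) {θ : ℝ → ℝ} {θ' : ℝ} {t : ℝ} (ht : t ∈ Icc 0 T)
    (hθ : HasDerivWithinAt θ θ' (Icc 0 T) t) {F : ℝ → UnitAddTorus (Fin 3) → G}
    (hF : IsSmoothSpaceTimeOn (Icc 0 T) F) (x : UnitAddTorus (Fin 3)) :
    advectiveDeriv T v (fun s y => θ s • F s y) t x = θ' • F t x + θ t • advectiveDeriv T v F t x := by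
  have htime : timeDerivWithin (Icc 0 T) (fun s y => θ s • F s y) t x =
      θ t • timeDerivWithin (Icc 0 T) F t x + θ' • F t x := by
    unfold timeDerivWithin
    show derivWithin (fun s => θ s • F s x) (Icc 0 T) t = _
    exact (hθ.smul (hF.hasDerivWithinAt_slice ht x)).derivWithin (uniqueDiffOn_Icc hT t ht)
  have hspace : Torus.fderiv (fun y => θ t • F t y) x (v t x) = θ t • Torus.fderiv (F t) x (v t x) := by
    unfold Torus.fderiv
    have e : liftAt (fun y => θ t • F t y) x = θ t • liftAt (F t) x := rfl
    rw [e, fderiv_const_smul (hasFDerivAt_liftAt (hF.isSmooth_slice ht) x).differentiableAt]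
    rfl
  rw [advectiveDeriv_apply, advectiveDeriv_apply, htime, hspace, smul_add]
  abel

/-- **Locality**: fields that agree on `[0,T] × T³` have the same transport derivative there
(the time derivative is taken within `[0,T]`). [folklore] -/
theorem advectiveDeriv_congr {F F' : ℝ → UnitAddTorus (Fin 3) → G} (h : ∀ s ∈ Icc 0 T, ∀ y, F s y = F' s y) {t : ℝ}
    (ht : t ∈ Icc 0 T) (x : UnitAddTorus (Fin 3)) : advectiveDeriv T v F t x = advectiveDeriv T v F' t x := by
  rw [advectiveDeriv_apply, advectiveDeriv_apply]
  have e : F t = F' t := funext fun y => h t ht y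
  congr 1
  · unfold timeDerivWithin
    exact derivWithin_congr (fun s hs => h s hs x) (h t ht x)
  · rw [e]

/-- **Constants minus a field**: `(∂ₜ + v·∇)(c - M) = -(∂ₜ + v·∇)M` for a jointly smooth `M`.
[folklore] -/
theorem advectiveDeriv_const_sub (hT : 0 < T) (c : G) {M : ℝ → UnitAddTorus (Fin 3) → G}
    (hM : IsSmoothSpaceTimeOn (Icc 0 T) M) {t : ℝ} (ht : t ∈ Icc 0 T) (x : UnitAddTorus (Fin 3)) :
    advectiveDeriv T v (fun s y => c - M s y) t x = -advectiveDeriv T v M t x := by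
  have e : ∀ s ∈ Icc 0 T, ∀ y, c - M s y = c + (-(ContinuousLinearMap.id ℝ G)) (M s y) := by
    intro s _ y
    simp [sub_eq_add_neg]
  rw [advectiveDeriv_congr e ht x, advectiveDeriv_const_add,
    advectiveDeriv_clm_apply hT hM (-(ContinuousLinearMap.id ℝ G)) ht x]
  simp

end Leibniz

/-! ## Matrix plumbing: products, transpose, columns, Jacobian matrices as continuous maps -/

section MatrixMaps

/-- **Matrix multiplication on `𝕄 = Matrix (Fin 3) (Fin 3) ℝ` is a continuous bilinear map** for
the elementwise sup norm (finite dimension). [folklore] -/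
theorem exists_matrixMulCLM : ∃ B : Matrix (Fin 3) (Fin 3) ℝ →L[ℝ] Matrix (Fin 3) (Fin 3) ℝ →L[ℝ] Matrix (Fin 3) (Fin 3) ℝ, ∀ X Y : Matrix (Fin 3) (Fin 3) ℝ, B X Y = X * Y := by
  let L₂ : Matrix (Fin 3) (Fin 3) ℝ →ₗ[ℝ] Matrix (Fin 3) (Fin 3) ℝ →L[ℝ] Matrix (Fin 3) (Fin 3) ℝ :=
    (LinearMap.toContinuousLinearMap : (Matrix (Fin 3) (Fin 3) ℝ →ₗ[ℝ] Matrix (Fin 3) (Fin 3) ℝ) ≃ₗ[ℝ] (Matrix (Fin 3) (Fin 3) ℝ →L[ℝ] Matrix (Fin 3) (Fin 3) ℝ)).toLinearMap.comp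
      (LinearMap.mul ℝ (Matrix (Fin 3) (Fin 3) ℝ))
  refine ⟨LinearMap.toContinuousLinearMap L₂, fun X Y => ?_⟩
  simp [L₂]

/-- **The transpose is a continuous linear map on `𝕄`.** [folklore] -/
theorem exists_transposeCLM : ∃ L : Matrix (Fin 3) (Fin 3) ℝ →L[ℝ] Matrix (Fin 3) (Fin 3) ℝ, ∀ X : Matrix (Fin 3) (Fin 3) ℝ, L X = Xᵀ := by
  let L₀ : Matrix (Fin 3) (Fin 3) ℝ →ₗ[ℝ] Matrix (Fin 3) (Fin 3) ℝ :=
    { toFun := fun X => Xᵀ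
      map_add' := fun X Y => Matrix.transpose_add X Y
      map_smul' := fun c X => Matrix.transpose_smul c X }
  exact ⟨LinearMap.toContinuousLinearMap L₀, fun X => rfl⟩

/-- **`BDSV.ofCols` is a continuous linear map** `(Fin 3 → ℝ³) →L 𝕄`. [folklore] -/
theorem exists_ofColsCLM : ∃ L : (Fin 3 → EuclideanSpace ℝ (Fin 3)) →L[ℝ] Matrix (Fin 3) (Fin 3) ℝ, ∀ S : Fin 3 → EuclideanSpace ℝ (Fin 3), L S = ofCols S := by
  let L₀ : (Fin 3 → EuclideanSpace ℝ (Fin 3)) →ₗ[ℝ] Matrix (Fin 3) (Fin 3) ℝ :=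
    { toFun := fun S => ofCols S
      map_add' := fun S S' => by ext i j; simp [ofCols]
      map_smul' := fun c S => by ext i j; simp [ofCols] }
  exact ⟨LinearMap.toContinuousLinearMap L₀, fun S => rfl⟩

/-- **The Jacobian-matrix map** `φ ↦ (φ(e_b)_a)_{ab}` from linear maps `ℝ³ →L ℝ³` to `𝕄` is a
continuous linear map. [folklore] -/
theorem exists_jacCLM : ∃ L : (EuclideanSpace ℝ (Fin 3) →L[ℝ] EuclideanSpace ℝ (Fin 3)) →L[ℝ] Matrix (Fin 3) (Fin 3) ℝ,
    ∀ (φ : EuclideanSpace ℝ (Fin 3) →L[ℝ] EuclideanSpace ℝ (Fin 3)) (a b : Fin 3), L φ a b = φ (EuclideanSpace.single b 1) a := by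
  let L₀ : (EuclideanSpace ℝ (Fin 3) →L[ℝ] EuclideanSpace ℝ (Fin 3)) →ₗ[ℝ] Matrix (Fin 3) (Fin 3) ℝ :=
    { toFun := fun φ => Matrix.of fun a b => φ (EuclideanSpace.single b 1) a
      map_add' := fun φ ψ => by ext a b; simp
      map_smul' := fun c φ => by ext a b; simp }
  exact ⟨LinearMap.toContinuousLinearMap L₀, fun φ a b => rfl⟩

end MatrixMaps

/-! ## `∇Φ_i = Id + jac ∇D_i` and `D_{t,q}∇Φ_i = -∇Φ_i Dv̄_q` -/

section GradPhi

variable {T : ℝ} {v : ℝ → UnitAddTorus (Fin 3) → EuclideanSpace ℝ (Fin 3)}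

/-- **`∇Φ_i = Id + jac(∇D_i)`**: the deformation matrix of `OnsagerBDSVPerturbation.lean` through
the Jacobian-matrix map and the field of spatial derivatives `BDSV.gradField`, for a smooth slice
`D_i(t)`. [folklore] -/
theorem gradPhi_eq_one_add_jac {L : (EuclideanSpace ℝ (Fin 3) →L[ℝ] EuclideanSpace ℝ (Fin 3)) →L[ℝ] Matrix (Fin 3) (Fin 3) ℝ}
    (hL : ∀ (φ : EuclideanSpace ℝ (Fin 3) →L[ℝ] EuclideanSpace ℝ (Fin 3)) (a b : Fin 3), L φ a b = φ (EuclideanSpace.single b 1) a)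
    {D : ℕ → ℝ → UnitAddTorus (Fin 3) → EuclideanSpace ℝ (Fin 3)} {i : ℕ} {t : ℝ} (hD : IsSmooth (D i t)) (x : UnitAddTorus (Fin 3)) :
    gradPhi D i t x = 1 + L (gradField (D i) t x) := by
  have hc : IsContDiff 1 (D i t) := hD.isContDiff (by simp)
  ext a b
  simp only [gradPhi, Matrix.add_apply, Matrix.of_apply, hL, gradField_apply,
    partialDeriv_eq_fderiv_apply hc]

/-- **`D_{t,q}∇Φ_i = -∇Φ_i Dv̄_q`** in the form `(∂ₜ + v·∇)∇Φ_i = jac(-∇v - ∇D_i ∘ ∇v)`: for a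
displacement `D_i` transported by `v` (`(∂ₜ + v·∇)D_i = -v` on `[0,T] × T³`), the matrix field
`∇Φ_i = Id + jac(∇D_i)` has transport derivative `jac((∂ₜ + v·∇)∇D_i) = jac(-∇v - ∇D_i ∘ ∇v)`
(the accepted `BDSV.advectiveDeriv_gradField_eq`); entrywise this is
`-(∇Φ_i Dv̄)_{ab} = -∑_c (∇Φ_i)_{ac} ∂_b v̄_c`. [cite: BuckmasterEtAl2018, Prop. 5.9 (proof: "D_{t,q}∇Φ_i = -∇Φ_i Dv̄_q")] -/
theorem advectiveDeriv_gradPhi_eq (hT : 0 < T) {L : (EuclideanSpace ℝ (Fin 3) →L[ℝ] EuclideanSpace ℝ (Fin 3)) →L[ℝ] Matrix (Fin 3) (Fin 3) ℝ}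
    (hL : ∀ (φ : EuclideanSpace ℝ (Fin 3) →L[ℝ] EuclideanSpace ℝ (Fin 3)) (a b : Fin 3), L φ a b = φ (EuclideanSpace.single b 1) a)
    (hv : IsSmoothSpaceTimeOn (Icc 0 T) v) {D : ℕ → ℝ → UnitAddTorus (Fin 3) → EuclideanSpace ℝ (Fin 3)} {i : ℕ}
    (hD : IsSmoothSpaceTimeOn (Icc 0 T) (D i))
    (htr : ∀ s ∈ Icc 0 T, ∀ x, advectiveDeriv T v (D i) s x = -v s x) {t : ℝ} (ht : t ∈ Icc 0 T)
    (x : UnitAddTorus (Fin 3)) :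
    advectiveDeriv T v (fun s y => gradPhi D i s y) t x =
      L (-gradField v t x - (gradField (D i) t x).comp (gradField v t x)) := by
  have hG : IsSmoothSpaceTimeOn (Icc 0 T) (gradField (D i)) := hD.gradField (uniqueDiffOn_Icc hT)
  have e : ∀ s ∈ Icc 0 T, ∀ y, gradPhi D i s y = (1 : Matrix (Fin 3) (Fin 3) ℝ) + L (gradField (D i) s y) :=
    fun s hs y => gradPhi_eq_one_add_jac hL (hD.isSmooth_slice hs) y
  rw [advectiveDeriv_congr (F' := fun s y => (1 : Matrix (Fin 3) (Fin 3) ℝ) + L (gradField (D i) s y)) e ht x,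
    advectiveDeriv_const_add, ← advectiveDeriv_gradField_eq hT hv hD htr ht x]
  exact advectiveDeriv_clm_apply hT hG L ht x

end GradPhi

end BDSV

end Literature.Analysis.FluidPDE
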